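import Mathlib.Tactic
import HarnessLib

/-!
# The graph-divisor norm identity and the well-definedness of substitution and of the transversal derivation

Kernel leaf for the W1 census line of cell `pub-hsemireg` (seat w1-aut-2 gen 15, note
`widen/W1/CODEC-w1aut2.md` §1; the same identities underlie w1-cx-2's code B, `w1cx2/cechS_codeB/README` §1).
On `S = E × E`, `E : y² = x³ − 1`, with `ω³ = 1`, the graph curves `c_z ∪ Γ_z` are cut out by
`g_z = x₂ − ω^z x₁`, and both exact kernels divide a numerator by `g_z` through the identity
`g_z · ḡ_z = y₂² − y₁²`, `ḡ_z = x₂² + ω^z x₁ x₂ + ω^{2z} x₁²`, followed by a Laurent division in `y₂`.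
The curve conditions are kernels of the substitution `x₂ ↦ ω^z x₁, y₂ ↦ ε y₁` (`ε = ±1`), and second-order
vanishing uses a derivation `D` of the coordinate ring with `D x = 2y`, `D y = 3x²`.

We prove, in any commutative ring:
* `norm_factor`: `x₂³ − u³ x₁³ = (x₂ − u x₁)(x₂² + u x₁ x₂ + u² x₁²)`;
* `graph_norm`: if `u³ = 1`, `x₁³ = y₁² + 1`, `x₂³ = y₂² + 1` then `(x₂ − u x₁)(x₂² + u x₁ x₂ + u² x₁²) = y₂² − y₁²`
  (the exact-division identity);
* `subst_respects_relation`: if `u³ = 1` and `e² = 1` then `(e y)² − (u x)³ + 1 = y² − x³ + 1`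
  (the substitution along a graph is well defined on the coordinate ring of `E`);
* `derivation_kills_relation`: `2y · (3x²) − 3x² · (2y) = 0`, i.e. the rule `D x = 2y`, `D y = 3x²` annihilates
  the derivative `2y·Dy − 3x²·Dx` of the relation `y² − x³ + 1` (so `D` descends to the coordinate ring);
* `cube_of_omega`: `u² + u + 1 = 0 → u³ = 1` (the primitive cube root used as `ω`), and `omega_sq_sq`: then `(u²)² = u`
  (the conorm for `z = 2` uses `ω⁴ = ω`).

Honest framing: elementary ring identities (theorems only); nothing here bears on HC / HC_CM / HC_AV.
-/

namespace Summit.Ventures.HSemireg.GraphNormDivision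

variable {R : Type*} [CommRing R]

/-- The norm factorisation behind the graph divisor: `x₂³ − u³x₁³ = (x₂ − u x₁)(x₂² + u x₁x₂ + u²x₁²)`. -/
theorem norm_factor (u x₁ x₂ : R) :
    x₂ ^ 3 - u ^ 3 * x₁ ^ 3 = (x₂ - u * x₁) * (x₂ ^ 2 + u * x₁ * x₂ + u ^ 2 * x₁ ^ 2) := by
  ring

/-- The exact-division identity of both W1 kernels: on `E × E` (`xᵢ³ = yᵢ² + 1`) with `u³ = 1`,
`g · ḡ = y₂² − y₁²` for `g = x₂ − u x₁`, `ḡ = x₂² + u x₁ x₂ + u² x₁²`. -/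
theorem graph_norm (u x₁ y₁ x₂ y₂ : R) (hu : u ^ 3 = 1)
    (h₁ : x₁ ^ 3 = y₁ ^ 2 + 1) (h₂ : x₂ ^ 3 = y₂ ^ 2 + 1) :
    (x₂ - u * x₁) * (x₂ ^ 2 + u * x₁ * x₂ + u ^ 2 * x₁ ^ 2) = y₂ ^ 2 - y₁ ^ 2 := by
  linear_combination h₂ - x₁ ^ 3 * hu - h₁

/-- The substitution `x ↦ u x`, `y ↦ e y` with `u³ = 1`, `e² = 1` preserves the Weierstrass relation,
so restriction along the graph of `(x, y) ↦ (u x, e y)` is well defined on the coordinate ring. -/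
theorem subst_respects_relation (u e x y : R) (hu : u ^ 3 = 1) (he : e ^ 2 = 1) :
    (e * y) ^ 2 - (u * x) ^ 3 + 1 = y ^ 2 - x ^ 3 + 1 := by
  linear_combination (y ^ 2) * he - (x ^ 3) * hu

/-- The rule `D x = 2y`, `D y = 3x²` annihilates the formal derivative of the relation `y² − x³ + 1`
(`2y · D y − 3x² · D x = 0`), so it defines a derivation of the coordinate ring of `E`; on the second
factor of `E × E` this derivation is the transversal field used for second-order vanishing along graphs. -/
theorem derivation_kills_relation (x y : R) :
    2 * y * (3 * x ^ 2) - 3 * x ^ 2 * (2 * y) = 0 := by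
  ring

/-- A root of `u² + u + 1` is a cube root of unity (the `ω` of `ℚ(ω)`). -/
theorem cube_of_omega (u : R) (h : u ^ 2 + u + 1 = 0) : u ^ 3 = 1 := by
  linear_combination (u - 1) * h

/-- With `ω² + ω + 1 = 0` the conorm `ḡ` for `z = 2` uses `ω⁴ = ω`: `(ω²)² = ω`. -/
theorem omega_sq_sq (u : R) (h : u ^ 2 + u + 1 = 0) : (u ^ 2) ^ 2 = u := by
  linear_combination (u ^ 2 - u) * h

end Summit.Ventures.HSemireg.GraphNormDivision
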